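import Literature.AlgebraicGeometry.Modules.FiniteType
import Mathlib.RingTheory.Finiteness.Ideal
import HarnessLib

/-!
# Annihilators: modules killed by an ideal sheaf on an affine covering; supports and powers of ideals

Two affine-local annihilator facts for sheaves of `𝒪_X`-modules which are affine-localizing
(`Modules/AffineLocalizing`) — the bookkeeping behind "a coherent module with support in `V(𝓘)` is
annihilated by a power of `𝓘`" (Hartshorne II Ex. 5.6 (b), (d); Görtz–Wedhorn I, proof of Lemma 12.63:
"we say that a coherent `𝒪_X`-module `𝒢` has support on `Z` if `𝓘𝒢 = 0`"):

* `IsKilledBy.of_iSup_eq_top` — **`𝒥 M = 0` may be checked on ONE affine open covering**: if `𝒥(V_k)`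
  annihilates `Γ(V_k, M)` for affine opens `V_k` covering `X`, then `𝒥(V)` annihilates `Γ(V, M)` for
  every affine open `V` (numerators of `M` on common principal opens `D(f) = D(g)`, Mathlib
  `exists_basicOpen_le_affine_inter`, and `𝒥(D(f)) = 𝒥(V_k)·Γ(D(f))`, `IdealSheafData.map_ideal`);
* `exists_isKilledBy_sup_pow` — **if `𝒥 M = 0`, `M` is of affine-finite type, `X` is locally Noetherian
  with a finite affine covering `(V_k)`, and the sections of `M` over each `V_k` vanish on the principal
  opens `D(g)`, `g ∈ 𝓘(V_k)` (i.e. `M` vanishes off `V(𝓘)`), then `(𝒥 + 𝓘ⁿ) M = 0` for some `n`**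
  (torsion of `M` on the generators, `Ideal.exists_pow_le_of_le_radical_of_fg`).

Everything is proved; no named facts. Mathlib searched (pin v4.32): `exists_basicOpen_le_affine_inter`,
`RingedSpace.isUnit_res_basicOpen`, `Submodule.annihilator`, `Submodule.mem_annihilator`,
`Ideal.exists_pow_le_of_le_radical_of_fg`, `Submodule.torsionBy` (used).

## References

* R. Hartshorne, *Algebraic Geometry*, GTM 52 (1977): II Ex. 5.6 (Support), p. 124 (PDF p. 157).
  [Hartshorne1977]
* U. Görtz, T. Wedhorn, *Algebraic Geometry I: Schemes*, 2nd ed. (2020): Lemma 12.63, proof, p. 436.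
  [GortzWedhorn2020]
-/

noncomputable section

open CategoryTheory AlgebraicGeometry TopologicalSpace Opposite

universe u

namespace Literature.AlgebraicGeometry.Modules

variable {X : Scheme.{u}} {M : X.Modules} (J : X.IdealSheafData)

/-- **`𝒥 M = 0` is checked on an affine open covering** (for `M` affine-localizing).
[cite: GortzWedhorn2020, Lemma 12.63 proof (p. 436)] -/
theorem IsKilledBy.of_iSup_eq_top (hM : IsAffineLocalizing M) {ι : Type*} (V : ι → X.affineOpens)
    (hV : ⨆ k, (V k : X.Opens) = ⊤)
    (hkill : ∀ (k : ι) (r : Γ(X, V k)), r ∈ J.ideal (V k) → ∀ m : Γ(M, V k), r • m = 0) :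
    IsKilledBy J M := by
  intro U r hr m
  -- cover `U` by principal opens `D(f)`, `f ∈ Γ(V_k)`, which are also principal in `U`
  let K : Type _ := {p : Σ k, Γ(X, V k) // ∃ g : Γ(X, U), X.basicOpen p.2 = X.basicOpen g}
  have hWU : ∀ p : K, X.basicOpen p.1.2 ≤ (U : X.Opens) := fun p =>
    p.2.choose_spec.trans_le (X.basicOpen_le _)
  have hcov : (U : X.Opens) ≤ ⨆ p : K, X.basicOpen p.1.2 := by
    intro x hx
    have hx' : x ∈ (⊤ : X.Opens) := trivial
    rw [← hV] at hx'
    obtain ⟨k, hk⟩ := Opens.mem_iSup.mp hx'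
    obtain ⟨f, g, hfg, hxf⟩ := exists_basicOpen_le_affine_inter (V k).2 U.2 x ⟨hk, hx⟩
    exact Opens.mem_iSup.mpr ⟨⟨⟨k, f⟩, g, hfg⟩, hxf⟩
  apply (abSheafOf M).eq_of_locally_eq' (fun p : K => X.basicOpen p.1.2) U (fun p => homOfLE (hWU p)) hcov
  intro p
  obtain ⟨⟨k, f⟩, g, hfg⟩ := p
  set W := X.basicOpen f with hWdef
  have hWU' : W ≤ (U : X.Opens) := hWU ⟨⟨k, f⟩, g, hfg⟩
  have hWV : W ≤ (V k : X.Opens) := X.basicOpen_le f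
  have hWaff : IsAffineOpen W := (V k).2.basicOpen f
  rw [map_zero]
  change M.presheaf.map (homOfLE hWU').op (r • m) = 0
  rw [Scheme.Modules.map_smul]
  -- numerators of `m|_W` in `V_k`
  obtain ⟨N, x, hx⟩ := hM.numerator (V k).2 f rfl (M.presheaf.map (homOfLE hWU').op m)
  -- `r|_W ∈ 𝒥(W) = 𝒥(V_k) Γ(W)` annihilates `x|_W`
  have hrW : X.presheaf.map (homOfLE hWU').op r ∈ J.ideal ⟨W, hWaff⟩ :=
    J.ideal_le_comap_ideal (U := ⟨W, hWaff⟩) (V := U) hWU' hr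
  have hann : ∀ s ∈ J.ideal ⟨W, hWaff⟩, s • M.presheaf.map (homOfLE hWV).op x = 0 := by
    intro s hs
    rw [← J.map_ideal (U := ⟨W, hWaff⟩) (V := V k) hWV] at hs
    refine Submodule.span_induction (p := fun s _ => s • M.presheaf.map (homOfLE hWV).op x = 0)
      ?_ ?_ ?_ ?_ hs
    · rintro _ ⟨j, hj, rfl⟩
      change X.presheaf.map (homOfLE hWV).op j • M.presheaf.map (homOfLE hWV).op x = 0
      rw [← Scheme.Modules.map_smul, hkill k j hj x, map_zero]
    · rw [zero_smul]
    · intro a b _ _ ha hb; rw [add_smul, ha, hb, add_zero]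
    · intro a b _ hb; rw [smul_eq_mul, mul_smul, hb, smul_zero]
  -- `f|_W^N • (r|_W • m|_W) = r|_W • x|_W = 0`, and `f|_W` is a unit
  have hu : IsUnit (X.presheaf.map (homOfLE hWV).op f) := X.toRingedSpace.isUnit_res_basicOpen f
  refine (IsUnit.smul_left_cancel (hu.pow N)).mp ?_
  rw [smul_zero, smul_comm, ← hx, hann _ hrW]

/-- **Supports and powers**: if `𝒥 M = 0`, `M` is affine-localizing of affine-finite type on the locally
Noetherian `X` with a finite affine open covering `(V_k)`, and the sections of `M` over the `V_k` vanish
on every `D(g)`, `g ∈ 𝓘(V_k)`, then `(𝒥 + 𝓘ⁿ) M = 0` for some `n`.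
[cite: Hartshorne1977, II Ex. 5.6 (p. 124)] -/
theorem exists_isKilledBy_sup_pow [IsLocallyNoetherian X] (hM : IsAffineLocalizing M)
    (hMft : IsAffineFiniteType M) {ι : Type*} [Finite ι] (V : ι → X.affineOpens)
    (hV : ⨆ k, (V k : X.Opens) = ⊤) {I : X.IdealSheafData} (hJ : IsKilledBy J M)
    (hI : ∀ (k : ι) (g : Γ(X, V k)), g ∈ I.ideal (V k) → ∀ m : Γ(M, V k),
      M.presheaf.map (homOfLE (X.basicOpen_le g)).op m = 0) :
    ∃ n : ℕ, IsKilledBy (J ⊔ I ^ n) M := by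
  classical
  -- on each `V_k`, a power of `𝓘(V_k)` annihilates `Γ(V_k, M)`
  have hk : ∀ k, ∃ n : ℕ, ∀ r ∈ I.ideal (V k) ^ n, ∀ m : Γ(M, V k), r • m = 0 := by
    intro k
    haveI : IsNoetherianRing Γ(X, (V k : X.Opens)) := IsLocallyNoetherian.component_noetherian (V k)
    haveI := hMft (V k).2
    set ann := (⊤ : Submodule Γ(X, (V k : X.Opens)) Γ(M, (V k : X.Opens))).annihilator
    have hrad : I.ideal (V k) ≤ ann.radical := by
      intro g hg
      -- `g` kills each of finitely many generators after a power
      obtain ⟨T, hT⟩ := Module.Finite.fg_top (R := Γ(X, (V k : X.Opens))) (M := Γ(M, (V k : X.Opens)))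
      have hgen : ∀ t ∈ T, ∃ e : ℕ, g ^ e • t = 0 := fun t _ =>
        hM.torsion (V k).2 g t (X.basicOpen_le g) le_rfl (hI k g hg t)
      choose! e he using hgen
      refine ⟨T.sup e, Submodule.mem_annihilator.mpr fun m _ => ?_⟩
      have hm : m ∈ Submodule.span Γ(X, (V k : X.Opens)) (T : Set Γ(M, (V k : X.Opens))) := by
        rw [hT]; trivial
      refine Submodule.span_induction (p := fun m _ => g ^ T.sup e • m = 0) ?_ ?_ ?_ ?_ hm
      · intro t ht
        rw [← pow_sub_mul_pow g (Finset.le_sup ht : e t ≤ T.sup e), mul_smul, he t ht, smul_zero]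
      · rw [smul_zero]
      · intro a b _ _ ha hb; rw [smul_add, ha, hb, add_zero]
      · intro c a _ ha; rw [smul_comm, ha, smul_zero]
    obtain ⟨n, hn⟩ := Ideal.exists_pow_le_of_le_radical_of_fg hrad (IsNoetherian.noetherian _)
    exact ⟨n, fun r hr m => Submodule.mem_annihilator.mp (hn hr) m trivial⟩
  choose n hn using hk
  haveI := Fintype.ofFinite ι
  refine ⟨Finset.univ.sup n, IsKilledBy.of_iSup_eq_top (J ⊔ I ^ Finset.univ.sup n) hM V hV ?_⟩
  intro k r hr m
  rw [Scheme.IdealSheafData.ideal_sup, Scheme.IdealSheafData.ideal_pow] at hr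
  obtain ⟨j, hj, i, hi, rfl⟩ := Submodule.mem_sup.mp hr
  rw [add_smul, hJ (V k) j hj m, zero_add]
  exact hn k i (Ideal.pow_le_pow_right (Finset.le_sup (Finset.mem_univ k)) hi) m

end Literature.AlgebraicGeometry.Modules

end
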